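import Summits.QuantumFields.YangMills.Theorems.OnsetCalibrationOnsetVanishes
import Summits.QuantumFields.YangMills.Theorems.SubOnsetCeilings.Negative.CubeKernelLaplace

/-!
# Crux K2 `SubOnsetCeilings` (stmt-QuantumFields-23313), line `dlr-collar-subonset` — negative side:
# the CLASSICAL boundary law is necessary for the stub

Let `Stub` be the registered stub `stub_centredBoundaryLaw6` of the line (sub-onset frozen-boundary law on
centred cubes, oscillation form; its statement is the hypothesis `hstub` below, verbatim) and K1 the route's
floor crux `OnsetFloors`.  We prove

  `Stub ∧ OnsetFloors ⇒ ClassicalBoundaryLaw`,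

where the **classical boundary law** says: for the K1 representation `r` there is ONE constant `C₁` such that
for every orientation `q`, site `x`, radius `R ≥ 1` and EVERY exterior `η`, the Dirichlet problem for the Wilson
boundary action `S_Λ` on the centred cube `Λ = cubeEdges (x − (R+1)) (2R+3)` has, for every `δ > 0`, a
`δ`-minimiser `U` (agreeing with `η` off `Λ`, `S_Λ U ≤ inf + δ`) whose centre plaquette defect is small:
`N − Re tr r(U_{p_q(x)}) ≤ 2C₁/R⁴ + δ` (by compactness this is the same as an exact minimiser with defect
`≤ 2C₁/R⁴`).  So a disprover may attack the XL quantum stub through a purely VARIATIONAL question about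
lattice Yang–Mills minimisers with Dirichlet data: exhibit exteriors `η_R` all of whose (near-)minimisers carry a
centre defect `≫ R⁻⁴`, and the line is dead modulo K1 (= the NT residual).

Proof.  K1 gives a live floor level, so the stub yields `C₁, ℓ₁, β₁`; by the landed U (`onsetVanishes_proof`)
the both-floor onset set at `β` lies below `ℓ₁/(2R+3)` for `β` large, and its supremum `s_β` is a sub-onset
resolution with `(2R+3)·s_β ≤ ℓ₁`; hence the kernel means of the centre plaquette under ANY two exteriors differ
by at most `2C₁/R⁴` for all large `β`.  Under the trivial exterior the kernel mean tends to `N` as `β → ∞`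
(Laplace principle on the compact fibre `G^Λ`: the boundary action is `≥ 0`, vanishes at the trivial
configuration, and near its minimum the centre plaquette is near `N`).  If every `δ`-minimiser for `η` had
centre defect `> 2C₁/R⁴ + δ`, the same Laplace principle would cap the kernel mean under `η` at
`N − 2C₁/R⁴ − δ + o(1)` — contradiction.

HONEST LABEL: nothing here proves or refutes the crux; it converts the first sanity check of the line's stub into
a classical statement.  No summit, no mass gap.
-/

set_option autoImplicit false

noncomputable section

open scoped SchwartzMap
open MeasureTheory Filter Topology
open Literature.MathematicalPhysics.QuantumFieldTheory hiding ZdEdge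
open Literature.MathematicalPhysics.QuantumLattice hiding cubeEdges cubeSites
open Literature.MathematicalPhysics.AQFT Literature.Probability.LatticeModels
open Summit.QuantumFields.YangMills.Cruxes.OSLegsFromFemtoAndGap.DlrCollarTransfer

namespace Summit.QuantumFields.YangMills.Theorems.SubOnsetCeilings.Negative

/-! ## §4 The classical boundary law from the stub and K1 -/

/-- **Classical necessity of the line's stub.**  If the registered stub `stub_centredBoundaryLaw6` of line
`dlr-collar-subonset` holds (hypothesis `hstub`, verbatim) and the route's floor crux K1 `OnsetFloors` holds, then
for every SU(2)-class `G` there are a lattice representation `r` and ONE constant `C₁` such that every Dirichlet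
problem for the Wilson boundary action on a centred cube of side `2R+3` (`R ≥ 1`), with ANY exterior `η`, has
`δ`-minimisers whose centre plaquette defect is at most `2C₁/R⁴ + δ`, for every `δ > 0`.  Contrapositive: a
family of exteriors `η_R` all of whose near-minimisers have centre defect `≫ R⁻⁴` refutes the stub given K1.
[folklore] -/
theorem classicalBoundaryLaw_of_stub_of_onsetFloors
    (hstub : ∀ (G : Type) [Group G] [TopologicalSpace G] [IsTopologicalGroup G] [CompactSpace G],
      IsCompactSimpleLieGroup G → Nonempty (G ≃ₜ* Matrix.specialUnitaryGroup (Fin 2) ℂ) →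
      letI : MeasurableSpace G := borel G
      haveI : BorelSpace G := ⟨rfl⟩
      ∀ (r : LatticeRep G) (v f g h : 𝓢(EuclideanSpace ℝ (Fin 4), ℝ)) (Λ₅ : ℝ),
        ∃ ε₀ : ℝ, 0 < ε₀ ∧ ∀ ε : ℝ, 0 < ε → ε ≤ ε₀ →
          (∃ β₅ : ℝ, ∀ β : ℝ, β₅ ≤ β → ∃ s : ℝ, 0 < s ∧ s ≤ 1 ∧
            (∀ L : ℕ, Λ₅ ≤ s * L → ε ≤ Q2 G r β L s (thetaTest 4 v) v) ∧
            (∀ L : ℕ, Λ₅ ≤ s * L → ε ≤ |Q3 G r β L s f g h|)) →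
          ∃ (C₁ ℓ₁ β₁ : ℝ), 0 < ℓ₁ ∧ 0 ≤ C₁ ∧ ∀ β : ℝ, β₁ ≤ β → ∀ s : ℝ, 0 < s → s ≤ 1 →
            (∀ s' : ℝ, 2 * s ≤ s' → s' ≤ 1 →
              ¬ ((∀ L : ℕ, Λ₅ ≤ s' * L → ε ≤ Q2 G r β L s' (thetaTest 4 v) v) ∧
                 (∀ L : ℕ, Λ₅ ≤ s' * L → ε ≤ |Q3 G r β L s' f g h|))) →
            ∀ (q : Fin 4 × Fin 4) (x : Fin 4 → ℤ) (R : ℕ), q.1 < q.2 → 1 ≤ R →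
              ((2 * R + 3 : ℕ) : ℝ) * s ≤ ℓ₁ →
                ∃ m : ℝ, ∀ η : LGConfig 4 G,
                  |kerE G r β (fun k => x k - (R + 1)) (2 * R + 3) η (plane G r q x) - m| ≤ C₁ / (R : ℝ) ^ 4)
    (hK1 : Summit.QuantumFields.YangMills.Theses.OnsetCalibration.OnsetFloors) :
    ∀ (G : Type) [Group G] [TopologicalSpace G] [IsTopologicalGroup G] [CompactSpace G],
      IsCompactSimpleLieGroup G → Nonempty (G ≃ₜ* Matrix.specialUnitaryGroup (Fin 2) ℂ) →
      letI : MeasurableSpace G := borel G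
      haveI : BorelSpace G := ⟨rfl⟩
      ∃ (r : LatticeRep G) (C₁ : ℝ), ∀ (q : Fin 4 × Fin 4) (x : Fin 4 → ℤ) (R : ℕ), q.1 < q.2 → 1 ≤ R →
        ∀ (η : LGConfig 4 G) (δ : ℝ), 0 < δ →
          ∃ U : LGConfig 4 G,
            (∀ e, e ∉ cubeEdges (fun k => x k - (R + 1)) (2 * R + 3) →
              U e = η e) ∧
            (∀ V : LGConfig 4 G,
              (∀ e, e ∉ cubeEdges (fun k => x k - (R + 1)) (2 * R + 3) →
                V e = η e) →
              wilsonBoundaryAction r.ρ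
                  (cubeEdges (fun k => x k - (R + 1)) (2 * R + 3)) U ≤
                wilsonBoundaryAction r.ρ
                  (cubeEdges (fun k => x k - (R + 1)) (2 * R + 3)) V + δ) ∧
            (r.N : ℝ) - plane G r q x U ≤ 2 * C₁ / (R : ℝ) ^ 4 + δ := by
  intro G _ _ _ _ hG hcl
  letI : MeasurableSpace G := borel G
  haveI : BorelSpace G := ⟨rfl⟩
  -- K1: a live floor datum; the stub's constants at the level `ε := min ε₁ ε₀`
  obtain ⟨r, v, f, g, h, ε₁, Λ₅, β₅, -, -, -, -, hε₁, hfloor⟩ := hK1 G hG hcl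
  obtain ⟨ε₀, hε₀, hst⟩ := hstub G hG hcl r v f g h Λ₅
  have hεpos : 0 < min ε₁ ε₀ := lt_min hε₁ hε₀
  have hlive : ∀ β : ℝ, β₅ ≤ β → ∃ s : ℝ, 0 < s ∧ s ≤ 1 ∧
      (∀ L : ℕ, Λ₅ ≤ s * L → min ε₁ ε₀ ≤ Q2 G r β L s (thetaTest 4 v) v) ∧
      (∀ L : ℕ, Λ₅ ≤ s * L → min ε₁ ε₀ ≤ |Q3 G r β L s f g h|) := by
    intro β hβ
    obtain ⟨s, hs0, hs1, h2, h3⟩ := hfloor β hβ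
    exact ⟨s, hs0, hs1, fun L hL => (min_le_left _ _).trans (h2 L hL),
      fun L hL => (min_le_left _ _).trans (h3 L hL)⟩
  obtain ⟨C₁, ℓ₁, β₁, hℓ₁, hC₁, hF⟩ := hst (min ε₁ ε₀) hεpos (min_le_right _ _) ⟨β₅, hlive⟩
  haveI : SecondCountableTopology G :=
    (r.continuous.isClosedEmbedding r.injective).isEmbedding.secondCountableTopology
  refine ⟨r, C₁, fun q x R hq hR η δ hδ => ?_⟩
  set Λ := cubeEdges (fun k => x k - (R + 1)) (2 * R + 3) with hΛ
  -- U (landed): for large β no resolution in [s₀, 1] carries the floors, s₀ := ℓ₁ / (2R+3)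
  have hs₀ : 0 < ℓ₁ / ((2 * R + 3 : ℕ) : ℝ) := div_pos hℓ₁ (by positivity)
  obtain ⟨βU, hβU⟩ := Summit.QuantumFields.YangMills.Theorems.OnsetCalibration.onsetVanishes_proof G hG hcl r v f g h
    (min ε₁ ε₀) Λ₅ (ℓ₁ / ((2 * R + 3 : ℕ) : ℝ)) hεpos hs₀
  -- the onset set (opaque) and its supremum: a sub-onset resolution below s₀ for β large
  obtain ⟨S, hS⟩ : ∃ S : ℝ → Set ℝ, ∀ β s, s ∈ S β ↔ (0 < s ∧ s ≤ 1 ∧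
      (∀ L : ℕ, Λ₅ ≤ s * L → min ε₁ ε₀ ≤ Q2 G r β L s (thetaTest 4 v) v) ∧
      (∀ L : ℕ, Λ₅ ≤ s * L → min ε₁ ε₀ ≤ |Q3 G r β L s f g h|)) :=
    ⟨fun β => {s | 0 < s ∧ s ≤ 1 ∧
      (∀ L : ℕ, Λ₅ ≤ s * L → min ε₁ ε₀ ≤ Q2 G r β L s (thetaTest 4 v) v) ∧
      (∀ L : ℕ, Λ₅ ≤ s * L → min ε₁ ε₀ ≤ |Q3 G r β L s f g h|)}, fun _ _ => Iff.rfl⟩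
  have hSbdd : ∀ β, BddAbove (S β) := fun β => ⟨1, fun s hs => ((hS β s).1 hs).2.1⟩
  have hosc : ∀ β : ℝ, max (max β₁ β₅) βU ≤ β → ∃ m : ℝ, ∀ η' : LGConfig 4 G,
      |kerE G r β (fun k => x k - (R + 1)) (2 * R + 3) η' (plane G r q x) - m| ≤ C₁ / (R : ℝ) ^ 4 := by
    intro β hβ
    have hβ₁ : β₁ ≤ β := le_trans (le_max_left _ _) (le_trans (le_max_left _ _) hβ)
    have hβ₅ : β₅ ≤ β := le_trans (le_max_right _ _) (le_trans (le_max_left _ _) hβ)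
    have hβU' : βU ≤ β := le_trans (le_max_right _ _) hβ
    have hne : (S β).Nonempty := by
      obtain ⟨s, hs0, hs1, h2, h3⟩ := hlive β hβ₅
      exact ⟨s, (hS β s).2 ⟨hs0, hs1, h2, h3⟩⟩
    -- every onset resolution is below s₀
    have hlt : ∀ s ∈ S β, s < ℓ₁ / ((2 * R + 3 : ℕ) : ℝ) := by
      intro s hs
      have hs' := (hS β s).1 hs
      by_contra hcon
      exact hβU β hβU' s (not_lt.1 hcon) hs'.2.1 ⟨hs'.2.2.1, hs'.2.2.2⟩
    have hsup_pos : 0 < sSup (S β) := by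
      obtain ⟨s, hs⟩ := hne
      exact lt_of_lt_of_le ((hS β s).1 hs).1 (le_csSup (hSbdd β) hs)
    have hsup_le1 : sSup (S β) ≤ 1 := csSup_le hne fun s hs => ((hS β s).1 hs).2.1
    have hsup_le : sSup (S β) ≤ ℓ₁ / ((2 * R + 3 : ℕ) : ℝ) := csSup_le hne fun s hs => (hlt s hs).le
    have hsub : ∀ s' : ℝ, 2 * sSup (S β) ≤ s' → s' ≤ 1 →
        ¬ ((∀ L : ℕ, Λ₅ ≤ s' * L → min ε₁ ε₀ ≤ Q2 G r β L s' (thetaTest 4 v) v) ∧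
           (∀ L : ℕ, Λ₅ ≤ s' * L → min ε₁ ε₀ ≤ |Q3 G r β L s' f g h|)) := by
      intro s' h2 hs1 hfl
      have hmem : s' ∈ S β := (hS β s').2 ⟨by linarith, hs1, hfl.1, hfl.2⟩
      have := le_csSup (hSbdd β) hmem
      linarith
    have hfem : ((2 * R + 3 : ℕ) : ℝ) * sSup (S β) ≤ ℓ₁ := by
      have h23 : (0 : ℝ) < ((2 * R + 3 : ℕ) : ℝ) := by positivity
      calc ((2 * R + 3 : ℕ) : ℝ) * sSup (S β) ≤ ((2 * R + 3 : ℕ) : ℝ) * (ℓ₁ / ((2 * R + 3 : ℕ) : ℝ)) :=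
            mul_le_mul_of_nonneg_left hsup_le h23.le
        _ = ℓ₁ := by field_simp
    exact hF β hβ₁ (sSup (S β)) hsup_pos hsup_le1 hsub q x R hq hR hfem
  -- the Dirichlet problem on Λ with exterior η: a minimiser on the compact fibre
  have hgl : Continuous fun ζ : ↥Λ → G => glueWith Λ ζ η :=
    (continuous_glueWith_prod Λ).comp (Continuous.prodMk continuous_const continuous_id)
  have hScont : Continuous fun ζ : ↥Λ → G => wilsonBoundaryAction r.ρ Λ (glueWith Λ ζ η) :=
    (continuous_wilsonBoundaryAction r.ρ r.continuous Λ).comp hgl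
  obtain ⟨ζ₀, -, hζ₀⟩ := isCompact_univ.exists_isMinOn Set.univ_nonempty hScont.continuousOn
  have hmin : ∀ ζ, wilsonBoundaryAction r.ρ Λ (glueWith Λ ζ₀ η) ≤ wilsonBoundaryAction r.ρ Λ (glueWith Λ ζ η) :=
    fun ζ => hζ₀ (Set.mem_univ ζ)
  -- suppose no δ-minimiser has a good centre
  by_contra hnone
  have hall : ∀ ζ : ↥Λ → G, wilsonBoundaryAction r.ρ Λ (glueWith Λ ζ η) <
      wilsonBoundaryAction r.ρ Λ (glueWith Λ ζ₀ η) + δ →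
      plane G r q x (glueWith Λ ζ η) ≤ (r.N : ℝ) - 2 * C₁ / (R : ℝ) ^ 4 - δ := by
    intro ζ hζ
    by_contra hgoodζ
    refine hnone ⟨glueWith Λ ζ η, fun e he => glueWith_apply_not_mem _ _ _ he, fun V hV => ?_, ?_⟩
    · have hVg := glueWith_restrict_eq Λ hV
      have := hmin (fun e : ↥Λ => V e)
      rw [hVg] at this
      linarith
    · linarith [not_le.1 hgoodζ]
  -- Laplace: cap under η, floor under the trivial exterior
  obtain ⟨pη, hpη, hcap⟩ := kerE_plane_le_of_nearMin r Λ η q x hδ hmin hall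
  have hθ : 0 < δ / 4 := by linarith
  obtain ⟨p₀, hp₀, hfloorK⟩ := kerE_plane_ge_trivial r hq x R hθ
  -- the two error terms tend to zero
  have herr : Tendsto (fun β : ℝ =>
      ((r.N : ℝ) + |(r.N : ℝ) - 2 * C₁ / (R : ℝ) ^ 4 - δ|) * (Real.exp (-(β * (δ / 2))) / pη) +
      ((r.N : ℝ) + |(r.N : ℝ) - δ / 4|) * (Real.exp (-(β * (δ / 4 / 2))) / p₀)) atTop (𝓝 0) := by
    have e1 : Tendsto (fun β : ℝ => Real.exp (-(β * (δ / 2)))) atTop (𝓝 0) :=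
      Real.tendsto_exp_atBot.comp (tendsto_neg_atTop_atBot.comp (tendsto_id.atTop_mul_const (by positivity)))
    have e2 : Tendsto (fun β : ℝ => Real.exp (-(β * (δ / 4 / 2)))) atTop (𝓝 0) :=
      Real.tendsto_exp_atBot.comp (tendsto_neg_atTop_atBot.comp (tendsto_id.atTop_mul_const (by positivity)))
    simpa using ((e1.div_const pη).const_mul ((r.N : ℝ) + |(r.N : ℝ) - 2 * C₁ / (R : ℝ) ^ 4 - δ|)).add
      ((e2.div_const p₀).const_mul ((r.N : ℝ) + |(r.N : ℝ) - δ / 4|))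
  obtain ⟨βE, hβE⟩ := Filter.eventually_atTop.1 ((tendsto_order.1 herr).2 (δ / 4) hθ)
  -- evaluate at a large β
  obtain ⟨β, hβ0, hβosc, hβE'⟩ : ∃ β : ℝ, 0 ≤ β ∧ max (max β₁ β₅) βU ≤ β ∧ βE ≤ β :=
    ⟨max (max (max (max β₁ β₅) βU) βE) 0, le_max_right _ _,
      le_trans (le_max_left _ _) (le_max_left _ _), le_trans (le_max_right _ _) (le_max_left _ _)⟩
  obtain ⟨m, hm⟩ := hosc β hβosc
  have h1 := hm η
  have h2 := hm (fun _ => 1)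
  have hcapβ := hcap β hβ0
  have hfloorβ := hfloorK β hβ0
  rw [← hΛ] at hfloorβ
  have herrβ := hβE β hβE'
  -- kerE is the kernel integral
  have hk1 : kerE G r β (fun k => x k - (R + 1)) (2 * R + 3) η (plane G r q x) =
      ∫ U, plane G r q x U ∂(ymSpecification (d := 4) r.ρ β Λ η) := rfl
  have hk2 : kerE G r β (fun k => x k - (R + 1)) (2 * R + 3) (fun _ => 1) (plane G r q x) =
      ∫ U, plane G r q x U ∂(ymSpecification (d := 4) r.ρ β Λ (fun _ => 1)) := rfl
  rw [hk1] at h1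
  rw [hk2] at h2
  have hd1 := (abs_le.1 h1).1
  have hd2 := (abs_le.1 h2).2
  set kη : ℝ := ∫ U, plane G r q x U ∂(ymSpecification (d := 4) r.ρ β Λ η) with hkη
  set k0 : ℝ := ∫ U, plane G r q x U ∂(ymSpecification (d := 4) r.ρ β Λ (fun _ => 1)) with hk0
  set T1 : ℝ := ((r.N : ℝ) + |(r.N : ℝ) - 2 * C₁ / (R : ℝ) ^ 4 - δ|) * (Real.exp (-(β * (δ / 2))) / pη) with hT1
  set T2 : ℝ := ((r.N : ℝ) + |(r.N : ℝ) - δ / 4|) * (Real.exp (-(β * (δ / 4 / 2))) / p₀) with hT2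
  set C : ℝ := C₁ / (R : ℝ) ^ 4 with hC
  have hC2 : 2 * C₁ / (R : ℝ) ^ 4 = 2 * C := by rw [hC]; ring
  rw [hC2] at hcapβ
  linarith

/-- **Exact-minimiser form of the classical boundary law** (compactness upgrade of
`classicalBoundaryLaw_of_stub_of_onsetFloors`): under the stub and K1, for the K1 representation there is ONE `C₁`
such that EVERY Dirichlet problem for the Wilson boundary action on a centred cube of side `2R+3` (`R ≥ 1`, any
exterior `η`) has an exact minimiser whose centre plaquette defect is at most `2C₁/R⁴`.  (The continuous function
`max (S − min S) (defect − 2C₁/R⁴)` on the compact fibre `G^Λ` has infimum `≤ 0` by the `δ`-form, hence a zero.)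
[folklore] -/
theorem classicalBoundaryLaw_exact_of_stub_of_onsetFloors
    (hstub : ∀ (G : Type) [Group G] [TopologicalSpace G] [IsTopologicalGroup G] [CompactSpace G],
      IsCompactSimpleLieGroup G → Nonempty (G ≃ₜ* Matrix.specialUnitaryGroup (Fin 2) ℂ) →
      letI : MeasurableSpace G := borel G
      haveI : BorelSpace G := ⟨rfl⟩
      ∀ (r : LatticeRep G) (v f g h : 𝓢(EuclideanSpace ℝ (Fin 4), ℝ)) (Λ₅ : ℝ),
        ∃ ε₀ : ℝ, 0 < ε₀ ∧ ∀ ε : ℝ, 0 < ε → ε ≤ ε₀ →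
          (∃ β₅ : ℝ, ∀ β : ℝ, β₅ ≤ β → ∃ s : ℝ, 0 < s ∧ s ≤ 1 ∧
            (∀ L : ℕ, Λ₅ ≤ s * L → ε ≤ Q2 G r β L s (thetaTest 4 v) v) ∧
            (∀ L : ℕ, Λ₅ ≤ s * L → ε ≤ |Q3 G r β L s f g h|)) →
          ∃ (C₁ ℓ₁ β₁ : ℝ), 0 < ℓ₁ ∧ 0 ≤ C₁ ∧ ∀ β : ℝ, β₁ ≤ β → ∀ s : ℝ, 0 < s → s ≤ 1 →
            (∀ s' : ℝ, 2 * s ≤ s' → s' ≤ 1 →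
              ¬ ((∀ L : ℕ, Λ₅ ≤ s' * L → ε ≤ Q2 G r β L s' (thetaTest 4 v) v) ∧
                 (∀ L : ℕ, Λ₅ ≤ s' * L → ε ≤ |Q3 G r β L s' f g h|))) →
            ∀ (q : Fin 4 × Fin 4) (x : Fin 4 → ℤ) (R : ℕ), q.1 < q.2 → 1 ≤ R →
              ((2 * R + 3 : ℕ) : ℝ) * s ≤ ℓ₁ →
                ∃ m : ℝ, ∀ η : LGConfig 4 G,
                  |kerE G r β (fun k => x k - (R + 1)) (2 * R + 3) η (plane G r q x) - m| ≤ C₁ / (R : ℝ) ^ 4)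
    (hK1 : Summit.QuantumFields.YangMills.Theses.OnsetCalibration.OnsetFloors) :
    ∀ (G : Type) [Group G] [TopologicalSpace G] [IsTopologicalGroup G] [CompactSpace G],
      IsCompactSimpleLieGroup G → Nonempty (G ≃ₜ* Matrix.specialUnitaryGroup (Fin 2) ℂ) →
      letI : MeasurableSpace G := borel G
      haveI : BorelSpace G := ⟨rfl⟩
      ∃ (r : LatticeRep G) (C₁ : ℝ), ∀ (q : Fin 4 × Fin 4) (x : Fin 4 → ℤ) (R : ℕ), q.1 < q.2 → 1 ≤ R →
        ∀ η : LGConfig 4 G,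
          ∃ U : LGConfig 4 G,
            (∀ e, e ∉ cubeEdges (fun k => x k - (R + 1)) (2 * R + 3) → U e = η e) ∧
            (∀ V : LGConfig 4 G, (∀ e, e ∉ cubeEdges (fun k => x k - (R + 1)) (2 * R + 3) → V e = η e) →
              wilsonBoundaryAction r.ρ (cubeEdges (fun k => x k - (R + 1)) (2 * R + 3)) U ≤
                wilsonBoundaryAction r.ρ (cubeEdges (fun k => x k - (R + 1)) (2 * R + 3)) V) ∧
            (r.N : ℝ) - plane G r q x U ≤ 2 * C₁ / (R : ℝ) ^ 4 := by
  intro G _ _ _ _ hG hcl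
  letI : MeasurableSpace G := borel G
  haveI : BorelSpace G := ⟨rfl⟩
  obtain ⟨r, C₁, hδ⟩ := classicalBoundaryLaw_of_stub_of_onsetFloors hstub hK1 G hG hcl
  refine ⟨r, C₁, fun q x R hq hR η => ?_⟩
  haveI : SecondCountableTopology G :=
    (r.continuous.isClosedEmbedding r.injective).isEmbedding.secondCountableTopology
  set Λ := cubeEdges (fun k => x k - (R + 1)) (2 * R + 3) with hΛ
  -- the Dirichlet problem on the compact fibre: a minimiser ζ₀ and the penalty Ψ
  have hgl : Continuous fun ζ : ↥Λ → G => glueWith Λ ζ η :=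
    (continuous_glueWith_prod Λ).comp (Continuous.prodMk continuous_const continuous_id)
  have hS : Continuous fun ζ : ↥Λ → G => wilsonBoundaryAction r.ρ Λ (glueWith Λ ζ η) :=
    (continuous_wilsonBoundaryAction r.ρ r.continuous Λ).comp hgl
  have hP : Continuous fun ζ : ↥Λ → G => plane G r q x (glueWith Λ ζ η) := (continuous_plane r q x).comp hgl
  obtain ⟨ζ₀, -, hζ₀⟩ := isCompact_univ.exists_isMinOn Set.univ_nonempty hS.continuousOn
  have hmin : ∀ ζ, wilsonBoundaryAction r.ρ Λ (glueWith Λ ζ₀ η) ≤ wilsonBoundaryAction r.ρ Λ (glueWith Λ ζ η) :=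
    fun ζ => hζ₀ (Set.mem_univ ζ)
  have hΨ : Continuous fun ζ : ↥Λ → G =>
      max (wilsonBoundaryAction r.ρ Λ (glueWith Λ ζ η) - wilsonBoundaryAction r.ρ Λ (glueWith Λ ζ₀ η))
        ((r.N : ℝ) - plane G r q x (glueWith Λ ζ η) - 2 * C₁ / (R : ℝ) ^ 4) :=
    (hS.sub continuous_const).max ((continuous_const.sub hP).sub continuous_const)
  obtain ⟨ζ₁, -, hζ₁⟩ := isCompact_univ.exists_isMinOn Set.univ_nonempty hΨ.continuousOn
  -- the penalty has infimum ≤ 0: δ-minimisers with good centre exist for every δ > 0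
  have hΨle : max (wilsonBoundaryAction r.ρ Λ (glueWith Λ ζ₁ η) - wilsonBoundaryAction r.ρ Λ (glueWith Λ ζ₀ η))
      ((r.N : ℝ) - plane G r q x (glueWith Λ ζ₁ η) - 2 * C₁ / (R : ℝ) ^ 4) ≤ 0 := by
    refine le_of_forall_pos_le_add fun δ hδp => ?_
    obtain ⟨U, hU, hUmin, hUdef⟩ := hδ q x R hq hR η δ hδp
    have hUg := glueWith_restrict_eq Λ hU
    have h1 := hζ₁ (Set.mem_univ (fun e : ↥Λ => U e))
    simp only [Set.mem_setOf_eq, hUg] at h1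
    have h2 : wilsonBoundaryAction r.ρ Λ U ≤ wilsonBoundaryAction r.ρ Λ (glueWith Λ ζ₀ η) + δ :=
      hUmin _ fun e he => glueWith_apply_not_mem _ _ _ he
    refine h1.trans ?_
    rw [zero_add]
    exact max_le (by linarith) (by linarith)
  have hA := (le_max_left _ _).trans hΨle
  have hB := (le_max_right _ _).trans hΨle
  refine ⟨glueWith Λ ζ₁ η, fun e he => glueWith_apply_not_mem _ _ _ he, fun V hV => ?_, by linarith⟩
  have hVg := glueWith_restrict_eq Λ hV
  have := hmin (fun e : ↥Λ => V e)
  rw [hVg] at this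
  linarith

end Summit.QuantumFields.YangMills.Theorems.SubOnsetCeilings.Negative

end
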